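import Literature.MathematicalPhysics.QuantumFieldTheory.Balaban1983to89.B6BlockDecayGtV1

/-!
# `Balaban1983to89.B6BlockDecayGradFactorsV1` — T. Bałaban, *Propagators and renormalization transformations for lattice gauge theories. II*,
# Commun. Math. Phys. **96** (1984) 223–250 [Balaban1984PropagatorsII], Prop. 2.5 p. 246, towards the member `|(∇GJ)(x)|` of (1.110) for
# the two-scale `G` of (2.90): the fine gradients `∇_λ∂H′_j`, `∇_λH_j`, `∇_λG^{(w′)}` have exponentially decaying BLOCK kernels for `tsV1`,
# uniformly — file 8 of the two-level decay programme

statement-level skeleton of published theorems with citation tags; proofs where landed; nothing here is a claim about the Yang–Mills mass gap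

p. 246: *"… derivatives of H′_j up to third order … are uniformly bounded and have a uniform exponential decay"*; [4] (1.110) p. 35:
*"|(GJ)(x)|, |(∇GJ)(x)|, … ≤ O(1)e^{−δ₀|y−y′|}|J|"*; [4] p. 29 lines 1–2 (the derivative `∂_νH_k` of the minimizer kernel, via [2] Lemma 2.4).

WHAT THIS FILE DOES.  The member `∇GJ` of (1.110) is NOT the composition of the member `GJ` with the fine gradient (which costs `η⁻¹ = n`):
differentiating (2.129) puts `∇_λ` on the FIRST factor of each product, and the three first factors have derivative kernels in the tree.
With the fine difference operator in the direction `λ` written out, `D_λ = n·(S_λ − I)`, `(S_λA)(b₀) = A(b₀ + e_λ)` (no new definition: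
`…B6SectAOperatorsV1.onE (LinearMap.funLeft ℝ ℝ σ_λ)`, §1 `Dop_comp_apply`), this file proves: §2 `D_λ∂H′_j`: the entry
`(c/n)·Re ∂_λ∂_{μ₀}H′(EK b₀₋, y)` (`DgradHp_single_apply`, r03's second-derivative kernel through `dker_re_two`) and the block bound
`(|c|/n·A₂, κ)` (`blockBound_DgradHp`); §3 `D_λH_j`: the entry `Re ∂_λH_j((EK b₀₋, μ₀), b)` = b05's `…B5Hk163TorusHolder.dker` (`DHj_single_apply`),
its decay (b05's `…B5Hk163TorusHolderDecay.norm_dker_bpt_le` BY NAME, `abs_DHj_entry_le`) and the block bound `(C_D(d+1), κ_H)` (`blockBound_DHj`);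
§4 `C̃^{(j)}_Λ` at the scaling with the `n`-dependence isolated (`blockBound_Ct_scaling`, gen 12's
`covt_kernel_decay_uniform`); §5 `D_λG^{(w′)}` at the scaling: [4] Prop. 1.2 (1.110) MEMBER 2 BY NAME (p19's `prop12Printed_allTori_allScales` → `Prop12Hyps.e110_1`, kernel
`DGk`; r03's `GE_apply_eq_sum_Gk`) gives the block bound `(O(1), δ₀)` (`blockBound_DGE_scaling`).

DICTIONARY / DIVERGENCES. (1) `∇` = [4] (1.4)/(1.108): forward difference with the factor `η⁻¹ = L^j` on the fine torus; ours `D_λ` acts on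
fine bond fields componentwise (`(D_λA)(x, μ₀) = n(A(x + e_λ, μ₀) − A(x, μ₀))`). (2) Carriers, position maps, metric as in files 3–7;
scaling `c = L^j` in §4 only. (3) No new definition, no new hypothesis.  NOT summit progress.  Unit `lit-balaban-p22` (gen 14), 2026-08-22.
-/

noncomputable section

open scoped InnerProductSpace BigOperators Matrix
open Finset

namespace Literature.MathematicalPhysics.QuantumFieldTheory.Balaban1983to89.B6BlockDecayGradFactorsV1

open LatticeFieldCalculus B5SectBStatements B5Eq117TorusCarriers B6SectADomainsV1 B6SectAOperatorsV1 B6SectAVectorModelV1 B6SectCOperators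
  B6SectCTwoScaleV1 B6SectCTwoScaleV1Lattice B5Eq118OneStroke
open BalabanImbrieJaffe1984to88.BIJ85AxialPropagator411 (BondSpace)
open B4Sect5Torus (IsPseudoDist SumBound)
open B4TorusKernel (periodConst)
open B4TorusKernel.MultiPeriod (torusSupNorm torusSupNorm_nonneg)
open B4Sect5Proof (latticeConst latticeConst_nonneg)
open B5Prop11Plancherel (Tor fine)
open B5Blocks16 (blockOf_bpt)
open B5G183Kernel (exists_eq_bpt)
open B5Action121 (sdiff_mulVec)
open B5Hk163Torus (HkOp)
open B5Hk163Strip (kappaN kappaN_pos kappa163 kappa163_pos)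
open B5Hk163TorusHolderDecay (CdecD CdecD_nonneg norm_dker_bpt_le)
open B5Kernel166Decay (periodConst_pos)
open B6LowerBound2153Torus (toT rep toT_rep)
open B6Hprime2132Holder (MGHD)
open B6Hprime2132Torus (HpOp iterD dker iterD_succ)
open B6HprimeOpNormV1 (EK_shift iterD_re_eq_sum card_filter_eq_le_one)
open B6HjGtOpNormV1 (Hj_single_eq_re qpE_whole_eq_zero_iff inner_QE_aE_whole)
open B6GOneLevelV1Bridge (GE_apply_eq_sum_Gk)
open B6BlockDecayCalculus (blockBound_of_entry blockBound_of_cubeSup torusDist_isPseudoDist)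
open B6CovTildeDecayV1 (covt_kernel_decay_uniform)
open B6BlockDecayHjCovV1 (blockOf_EK_eq_iterBlockOf card_fiber_src_le blockBound_Ct_of_entry)
open B6BlockDecayHprimeCovV1 (supDist_cast_eq_torusSupNorm eq_of_torusDist_le_zero gradHp_single_apply abs_dker_re_le MGHD_nonneg)
open BalabanImbrieJaffe1984to88.BIJ85Ineq722Torus (torusRep torusRep_dY mem_cube_blk)
open BalabanImbrieJaffe1984to88.BIJ85Ineq722DeltaA (Gk DGk deltaAData)
open BalabanImbrieJaffe1984to88.BIJ85Ineq722ProofPart2 (prop12Hyps_of_ineq110_114)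
open BalabanImbrieJaffe1984to88.BIJ85Prop12AllTori (prop12Printed_allTori_allScales)

/-! ## §1  The fine difference operator `D_λ = n(S_λ − I)` on fine bond fields, written out -/

section Dop

variable {P : Params}

/-- `((s(S_λ − I)) ∘ X)(e)(b₀) = s·(X(e)(b₀ + e_λ) − X(e)(b₀))`: the fine difference in the direction `λ` of the image `X e` ([4] (1.4):
*"(∂_μ f)(x) = η⁻¹(f(x + ηe_μ) − f(x))"* componentwise). [cite: Balaban1984PropagatorsI, (1.4) p.18] -/
theorem Dop_comp_apply {E : Type*} [AddCommGroup E] [Module ℝ E] (s : ℝ) (lam : Fin P.d) (X : E →ₗ[ℝ] BondSpace P) (e : E) (b₀ : PBond P 0) :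
    (((s • (onE (LinearMap.funLeft ℝ ℝ (fun b : PBond P 0 => (⟨b.src.shift lam, b.dir⟩ : PBond P 0))) - LinearMap.id) :
        BondSpace P →ₗ[ℝ] BondSpace P)) ∘ₗ X) e b₀ =
      s * (X e ⟨b₀.src.shift lam, b₀.dir⟩ - X e b₀) := by
  rw [LinearMap.comp_apply, LinearMap.smul_apply, LinearMap.sub_apply, LinearMap.id_apply, PiLp.smul_apply, PiLp.sub_apply, smul_eq_mul]
  rfl

end Dop

/-! ## §2  `D_λ∂H′_j`: second-derivative kernels of `H′_j` -/

section DgradHp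

variable {P : Params} {c : ℝ} (hc : c ≠ 0) {j : ℕ} (hj : j ≤ P.m + P.K) (Λ' : Finset (Site P (j + 1))) (w : CIdx j Λ' → ℝ)

include hj in
/-- **`Re ∂_λ∂_{μ₀}H′ = n·(Re ∂_{μ₀}H′(· + e_λ) − Re ∂_{μ₀}H′)`** read at fine points `EK x` (r03's `iterD_succ` on the column `H′e_y`).
[cite: Balaban1984PropagatorsI, (1.4) p.18; Balaban1984PropagatorsII, p.246 («derivatives of H′_j up to third order»)] -/
theorem dker_re_two (lam μ₀ : Fin P.d) (x : Site P 0) (y : Site P j) :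
    (dker (P.L ^ j) (Mk P j) ![lam, μ₀] (EK hj x) y).re =
      ((P.L : ℝ) ^ j) * ((dker (P.L ^ j) (Mk P j) ![μ₀] (EK hj (x.shift lam)) y).re - (dker (P.L ^ j) (Mk P j) ![μ₀] (EK hj x) y).re) := by
  classical
  -- the column `H′e_y` and its iterated differences
  have e : ∀ {mo : ℕ} (νs : Fin mo → Fin P.d) (z : Tor (fine (P.L ^ j) (Mk P j))),
      (dker (P.L ^ j) (Mk P j) νs z y).re =
        (iterD (P.L ^ j) (Mk P j) mo νs (HpOp (P.L ^ j) (Mk P j) *ᵥ cplxS (tSc (WithLp.ofLp (EuclideanSpace.single y (1 : ℝ))))) z).re := by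
    intro mo νs z
    rw [iterD_re_eq_sum]
    simp only [PiLp.single_apply, mul_ite, mul_one, mul_zero, Finset.sum_ite_eq', Finset.mem_univ, if_true]
  rw [e, e, e, iterD_succ, sdiff_mulVec, show Fin.tail ![lam, μ₀] = ![μ₀] from Fin.tail_cons _ _,
    show (![lam, μ₀] : Fin 2 → Fin P.d) 0 = lam from rfl, ← EK_shift hj]
  simp only [Complex.mul_re, Complex.sub_re, Complex.natCast_re, Complex.natCast_im, zero_mul, sub_zero]
  push_cast
  ring

include hj in
/-- **THE ENTRIES OF `D_λ∂H′_j`**: `(D_λ∂H′_j)(e_y)_{b₀} = (c/n)·Re ∂_λ∂_{μ₀}H′(EK b₀₋, y)` (file 4's `gradHp_single_apply` at `b₀` and `b₀ + e_λ`).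
[cite: Balaban1984PropagatorsII, p.246 («derivatives of H′_j up to third order»)] -/
theorem DgradHp_single_apply (lam : Fin P.d) (y : Site P j) (b₀ : PBond P 0) :
    (((((P.L : ℝ) ^ j) • (onE (LinearMap.funLeft ℝ ℝ (fun b : PBond P 0 => (⟨b.src.shift lam, b.dir⟩ : PBond P 0))) - LinearMap.id) :
        BondSpace P →ₗ[ℝ] BondSpace P)) ∘ₗ
        ((tsV1 hc Λ' w).grad ∘ₗ (tsV1 hc Λ' w).hP)) (EuclideanSpace.single y (1 : ℝ)) b₀ =
      c / (P.L : ℝ) ^ j * (dker (P.L ^ j) (Mk P j) ![lam, b₀.dir] (EK hj b₀.src) y).re := by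
  rw [Dop_comp_apply, gradHp_single_apply hc hj Λ' w y ⟨b₀.src.shift lam, b₀.dir⟩, gradHp_single_apply hc hj Λ' w y b₀, dker_re_two hj]
  ring

end DgradHp

section DgradHpBlock

variable {d L m K : ℕ} [NeZero L] {hd : 1 ≤ d + 1} {hL : Odd L ∧ 1 < L} {c : ℝ} (hc : c ≠ 0) {j : ℕ}
  (hj : j ≤ (⟨d + 1, L, m, K, hd, hL⟩ : Params).m + (⟨d + 1, L, m, K, hd, hL⟩ : Params).K)
  (Λ' : Finset (Site (⟨d + 1, L, m, K, hd, hL⟩ : Params) (j + 1))) (w : CIdx j Λ' → ℝ)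

include hj in
/-- **THE ENTRIES OF `D_λ∂H′_j` DECAY**: `|(D_λ∂H′_j)(e_y)_{b₀}| ≤ (|c|/n)·A₂·e^{−κ|y(b₀₋) − y|_T}`, `A₂ = MGHD(d+1,2)·periodConst(κ_N(d+1),d)` (file 4's
`abs_dker_re_le`, m = 2). [cite: Balaban1984PropagatorsII, p.246 (text after (2.132))] -/
theorem abs_DgradHp_entry_le (lam : Fin (d + 1)) (y : Site (⟨d + 1, L, m, K, hd, hL⟩ : Params) j) (b₀ : PBond (⟨d + 1, L, m, K, hd, hL⟩ : Params) 0) :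
    |(((((L : ℝ) ^ j) • (onE (LinearMap.funLeft ℝ ℝ (fun b : PBond (⟨d + 1, L, m, K, hd, hL⟩ : Params) 0 =>
        (⟨b.src.shift lam, b.dir⟩ : PBond (⟨d + 1, L, m, K, hd, hL⟩ : Params) 0))) - LinearMap.id) :
          BondSpace (⟨d + 1, L, m, K, hd, hL⟩ : Params) →ₗ[ℝ] BondSpace (⟨d + 1, L, m, K, hd, hL⟩ : Params))) ∘ₗ
        ((tsV1 hc Λ' w).grad ∘ₗ (tsV1 hc Λ' w).hP)) (EuclideanSpace.single y (1 : ℝ)) b₀| ≤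
      |c| / (L : ℝ) ^ j * (MGHD (d + 1) 2 * periodConst (kappaN (d + 1)) d) * Real.exp (-(kappaN (d + 1) / ((d : ℝ) + 1) *
        torusSupNorm (Mk (⟨d + 1, L, m, K, hd, hL⟩ : Params) j)
          (rep (Mk (⟨d + 1, L, m, K, hd, hL⟩ : Params) j) (iterBlockOf j b₀.src) - rep (Mk (⟨d + 1, L, m, K, hd, hL⟩ : Params) j) y))) := by
  have hLj : (0 : ℝ) < (L : ℝ) ^ j := pow_pos (Nat.cast_pos.2 (Nat.pos_of_ne_zero (NeZero.ne L))) _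
  have h := DgradHp_single_apply (P := (⟨d + 1, L, m, K, hd, hL⟩ : Params)) hc hj Λ' w lam y b₀
  rw [show (((⟨d + 1, L, m, K, hd, hL⟩ : Params).L : ℝ) ^ j) = (L : ℝ) ^ j from rfl] at h
  rw [h, abs_mul, abs_div, abs_of_pos hLj, mul_assoc]
  exact mul_le_mul_of_nonneg_left (abs_dker_re_le hj (by norm_num) ![lam, b₀.dir] b₀.src y) (by positivity)

include hj in
/-- **block bound for `D_λ∂H′_j`** (unit sites → fine bonds): `(|c|/n·A₂, κ)`. [cite: Balaban1984PropagatorsII, p.246 (text after (2.132))] -/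
theorem blockBound_DgradHp (lam : Fin (d + 1)) (b₀ : PBond (⟨d + 1, L, m, K, hd, hL⟩ : Params) 0) (y : Site (⟨d + 1, L, m, K, hd, hL⟩ : Params) j) :
    ∑ y' ∈ univ.filter (fun y' : Site (⟨d + 1, L, m, K, hd, hL⟩ : Params) j => y' = y),
        |(((((L : ℝ) ^ j) • (onE (LinearMap.funLeft ℝ ℝ (fun b : PBond (⟨d + 1, L, m, K, hd, hL⟩ : Params) 0 =>
          (⟨b.src.shift lam, b.dir⟩ : PBond (⟨d + 1, L, m, K, hd, hL⟩ : Params) 0))) - LinearMap.id) :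
          BondSpace (⟨d + 1, L, m, K, hd, hL⟩ : Params) →ₗ[ℝ] BondSpace (⟨d + 1, L, m, K, hd, hL⟩ : Params))) ∘ₗ
          ((tsV1 hc Λ' w).grad ∘ₗ (tsV1 hc Λ' w).hP)) (EuclideanSpace.single y' (1 : ℝ)) b₀| ≤
      |c| / (L : ℝ) ^ j * (MGHD (d + 1) 2 * periodConst (kappaN (d + 1)) d) * ((1 : ℕ) : ℝ) * Real.exp (-(kappaN (d + 1) / ((d : ℝ) + 1) *
        torusSupNorm (Mk (⟨d + 1, L, m, K, hd, hL⟩ : Params) j)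
          (rep (Mk (⟨d + 1, L, m, K, hd, hL⟩ : Params) j) (iterBlockOf j b₀.src) - rep (Mk (⟨d + 1, L, m, K, hd, hL⟩ : Params) j) y))) := by
  have hLj : (0 : ℝ) < (L : ℝ) ^ j := pow_pos (Nat.cast_pos.2 (Nat.pos_of_ne_zero (NeZero.ne L))) _
  exact blockBound_of_entry (ρ := (fun t t' : Site (⟨d + 1, L, m, K, hd, hL⟩ : Params) j => torusSupNorm (Mk (⟨d + 1, L, m, K, hd, hL⟩ : Params) j) (rep (Mk (⟨d + 1, L, m, K, hd, hL⟩ : Params) j) t - rep (Mk (⟨d + 1, L, m, K, hd, hL⟩ : Params) j) t')))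
    _ (fun b₀ : PBond (⟨d + 1, L, m, K, hd, hL⟩ : Params) 0 => iterBlockOf j b₀.src)
    (fun y : Site (⟨d + 1, L, m, K, hd, hL⟩ : Params) j => y)
    (mul_nonneg (div_nonneg (abs_nonneg c) hLj.le) (mul_nonneg (MGHD_nonneg _ _) (periodConst_pos (kappaN_pos _) _).le))
    (card_filter_eq_le_one (P := (⟨d + 1, L, m, K, hd, hL⟩ : Params)) (j := j)) (fun b₀ y => abs_DgradHp_entry_le hc hj Λ' w lam y b₀) b₀ y

end DgradHpBlock

/-! ## §3  `D_λH_j`: b05's derivative kernel `∂_λH_k` of the minimizer -/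

section DHj

variable {d L m K : ℕ} [NeZero L] {hd : 1 ≤ d + 1} {hL : Odd L ∧ 1 < L} {c : ℝ} (hc : c ≠ 0) {j : ℕ}
  (hj : j + 1 ≤ (⟨d + 1, L, m, K, hd, hL⟩ : Params).m + (⟨d + 1, L, m, K, hd, hL⟩ : Params).K)
  (Λ' : Finset (Site (⟨d + 1, L, m, K, hd, hL⟩ : Params) (j + 1))) {w : CIdx j Λ' → ℝ} (hw : ∀ i, 0 < w i)
  [DecidableEq (PBond (⟨d + 1, L, m, K, hd, hL⟩ : Params) j)]

include hj hw in
/-- **THE ENTRIES OF `D_λH_j`**: `(D_λH_j)(e_b)_{b₀} = Re ∂_λH_j((EK b₀₋, μ₀), (b₋, μ(b)))`, b05's kernel `dker μ₀ μ(b) λ` of `∂_λH_k`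
(gen 9's `Hj_single_eq_re` at `b₀` and `b₀ + e_λ`). [cite: Balaban1984PropagatorsI, p.29 lines 1–2; Balaban1984PropagatorsII, (2.130) p.246] -/
theorem DHj_single_apply (lam : Fin (d + 1)) (b : PBond (⟨d + 1, L, m, K, hd, hL⟩ : Params) j) (b₀ : PBond (⟨d + 1, L, m, K, hd, hL⟩ : Params) 0) :
    (((((L : ℝ) ^ j) • (onE (LinearMap.funLeft ℝ ℝ (fun b : PBond (⟨d + 1, L, m, K, hd, hL⟩ : Params) 0 =>
        (⟨b.src.shift lam, b.dir⟩ : PBond (⟨d + 1, L, m, K, hd, hL⟩ : Params) 0))) - LinearMap.id) :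
          BondSpace (⟨d + 1, L, m, K, hd, hL⟩ : Params) →ₗ[ℝ] BondSpace (⟨d + 1, L, m, K, hd, hL⟩ : Params))) ∘ₗ (tsV1 hc Λ' w).Hj)
        (EuclideanSpace.single b (1 : ℝ)) b₀ =
      (B5Hk163TorusHolder.dker ((⟨d + 1, L, m, K, hd, hL⟩ : Params).L ^ j) (Mk (⟨d + 1, L, m, K, hd, hL⟩ : Params) j) b₀.dir b.dir lam
        (EK (Nat.le_of_succ_le hj) b₀.src) b.src).re := by
  rw [Dop_comp_apply, Hj_single_eq_re hc hj Λ' hw b ⟨b₀.src.shift lam, b₀.dir⟩, Hj_single_eq_re hc hj Λ' hw b b₀]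
  unfold B5Hk163TorusHolder.dker
  rw [show (⟨b₀.src.shift lam, b₀.dir⟩ : PBond (⟨d + 1, L, m, K, hd, hL⟩ : Params) 0).src = b₀.src.shift lam from rfl,
    show (⟨b₀.src.shift lam, b₀.dir⟩ : PBond (⟨d + 1, L, m, K, hd, hL⟩ : Params) 0).dir = b₀.dir from rfl, EK_shift (Nat.le_of_succ_le hj)]
  simp only [Complex.mul_re, Complex.sub_re, Complex.natCast_re, Complex.natCast_im, zero_mul, sub_zero]
  push_cast
  rfl

include hj hw in
/-- **THE ENTRIES OF `D_λH_j` DECAY**: `|(D_λH_j)(e_b)_{b₀}| ≤ C_D(d+1)·e^{−κ_H|y(b₀₋) − b₋|_T}`, `C_D = CdecD d = MD163(d+1)·periodConst(κ₁₆₃(d+1),d)`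
(b05's `norm_dker_bpt_le` BY NAME, read at a fine point through its block). [cite: Balaban1984PropagatorsI, p.29 lines 1–2] -/
theorem abs_DHj_entry_le (lam : Fin (d + 1)) (b₀ : PBond (⟨d + 1, L, m, K, hd, hL⟩ : Params) 0) (b : PBond (⟨d + 1, L, m, K, hd, hL⟩ : Params) j) :
    |(((((L : ℝ) ^ j) • (onE (LinearMap.funLeft ℝ ℝ (fun b : PBond (⟨d + 1, L, m, K, hd, hL⟩ : Params) 0 =>
        (⟨b.src.shift lam, b.dir⟩ : PBond (⟨d + 1, L, m, K, hd, hL⟩ : Params) 0))) - LinearMap.id) :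
          BondSpace (⟨d + 1, L, m, K, hd, hL⟩ : Params) →ₗ[ℝ] BondSpace (⟨d + 1, L, m, K, hd, hL⟩ : Params))) ∘ₗ (tsV1 hc Λ' w).Hj)
        (EuclideanSpace.single b (1 : ℝ)) b₀| ≤
      CdecD d * Real.exp (-((kappa163 (d + 1) / ((d : ℝ) + 1)) * torusSupNorm (Mk (⟨d + 1, L, m, K, hd, hL⟩ : Params) j)
        (rep (Mk (⟨d + 1, L, m, K, hd, hL⟩ : Params) j) (iterBlockOf j b₀.src) - rep (Mk (⟨d + 1, L, m, K, hd, hL⟩ : Params) j) b.src))) := by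
  have hj' : j ≤ m + K := Nat.le_of_succ_le hj
  rw [DHj_single_apply hc hj Λ' hw]
  obtain ⟨y', r, h⟩ := exists_eq_bpt (L ^ j) (Mk (⟨d + 1, L, m, K, hd, hL⟩ : Params) j) (EK hj' b₀.src)
  have hb : iterBlockOf j b₀.src = y' := by
    rw [← blockOf_EK_eq_iterBlockOf hj', h, blockOf_bpt]
  rw [hb, h]
  have h2 := norm_dker_bpt_le (L ^ j) (Mk (⟨d + 1, L, m, K, hd, hL⟩ : Params) j) b₀.dir b.dir lam r
    (rep (Mk (⟨d + 1, L, m, K, hd, hL⟩ : Params) j) y') (rep (Mk (⟨d + 1, L, m, K, hd, hL⟩ : Params) j) b.src)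
  rw [toT_rep, toT_rep] at h2
  exact (Complex.abs_re_le_norm _).trans h2

include hj hw in
/-- **block bound for `D_λH_j`** (unit bonds → fine bonds; the `d+1` unit bonds over a unit site): `(C_D(d+1), κ_H)`.
[cite: Balaban1984PropagatorsI, p.29 lines 1–2; Balaban1984PropagatorsII, (2.130) p.246] -/
theorem blockBound_DHj (lam : Fin (d + 1)) (b₀ : PBond (⟨d + 1, L, m, K, hd, hL⟩ : Params) 0) (y : Site (⟨d + 1, L, m, K, hd, hL⟩ : Params) j) :
    ∑ b ∈ univ.filter (fun b : PBond (⟨d + 1, L, m, K, hd, hL⟩ : Params) j => b.src = y),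
        |(((((L : ℝ) ^ j) • (onE (LinearMap.funLeft ℝ ℝ (fun b : PBond (⟨d + 1, L, m, K, hd, hL⟩ : Params) 0 =>
          (⟨b.src.shift lam, b.dir⟩ : PBond (⟨d + 1, L, m, K, hd, hL⟩ : Params) 0))) - LinearMap.id) :
          BondSpace (⟨d + 1, L, m, K, hd, hL⟩ : Params) →ₗ[ℝ] BondSpace (⟨d + 1, L, m, K, hd, hL⟩ : Params))) ∘ₗ (tsV1 hc Λ' w).Hj)
          (EuclideanSpace.single b (1 : ℝ)) b₀| ≤
      CdecD d * ((1 * (d + 1) : ℕ) : ℝ) * Real.exp (-((kappa163 (d + 1) / ((d : ℝ) + 1)) * torusSupNorm (Mk (⟨d + 1, L, m, K, hd, hL⟩ : Params) j)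
        (rep (Mk (⟨d + 1, L, m, K, hd, hL⟩ : Params) j) (iterBlockOf j b₀.src) - rep (Mk (⟨d + 1, L, m, K, hd, hL⟩ : Params) j) y))) :=
  blockBound_of_entry (ρ := (fun t t' : Site (⟨d + 1, L, m, K, hd, hL⟩ : Params) j => torusSupNorm (Mk (⟨d + 1, L, m, K, hd, hL⟩ : Params) j) (rep (Mk (⟨d + 1, L, m, K, hd, hL⟩ : Params) j) t - rep (Mk (⟨d + 1, L, m, K, hd, hL⟩ : Params) j) t')))
    _ (fun b₀ : PBond (⟨d + 1, L, m, K, hd, hL⟩ : Params) 0 => iterBlockOf j b₀.src) (fun b : PBond (⟨d + 1, L, m, K, hd, hL⟩ : Params) j => b.src)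
    (CdecD_nonneg (d := d)) (card_fiber_src_le (P := (⟨d + 1, L, m, K, hd, hL⟩ : Params))) (fun b₀ b => abs_DHj_entry_le hc hj Λ' hw lam b₀ b) b₀ y

end DHj

/-! ## §4  `C̃^{(j)}_Λ` at the scaling: gen 12's decay with the `n`-dependence isolated -/

section CtScaling

variable {d L m K : ℕ} {hd : 1 ≤ d + 1} {hL : Odd L ∧ 1 < L} {j : ℕ}


open Classical in
/-- **THE ENTRY DECAY OF `C̃^{(j)}_Λ` AS A BLOCK BOUND AT THE SCALING** (`c = L^j`, weights `a₀n^{d+1} ≤ w ≤ a₁n^{d+1}`): `∃ δ > 0, E ≥ 0` (depending on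
`d, L, a₀` only) with `Σ_{b′ : b′₋ = y}|C̃^{(j)}_Λ(e_{b′})_b| ≤ (E/n^{d+1})·e^{−δ|b₋ − y|_T}` for all volumes, `j + 1 ≤ m + K`, `Λ′`, weights in the window
(gen 12's `covt_kernel_decay_uniform`: entries `≤ 2Γ/min(a₀κ, κ)`, `κ = n^{d+1}` at the scaling; file 3's `blockBound_Ct_of_entry`).
[cite: Balaban1984PropagatorsII, p.246 (text after (2.128))] -/
theorem blockBound_Ct_scaling (d L : ℕ) (hd : 1 ≤ d + 1) (hL : Odd L ∧ 1 < L) {a₀ a₁ : ℝ} (ha₀ : 0 < a₀) (ha₁ : a₀ ≤ a₁) :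
    ∃ δ : ℝ, 0 < δ ∧ ∃ E : ℝ, 0 ≤ E ∧ ∀ (m K : ℕ) (j : ℕ) (hc : ((L : ℝ) ^ j) ≠ 0)
      (_hj : j + 1 ≤ (⟨d + 1, L, m, K, hd, hL⟩ : Params).m + (⟨d + 1, L, m, K, hd, hL⟩ : Params).K)
      (Λ' : Finset (Site (⟨d + 1, L, m, K, hd, hL⟩ : Params) (j + 1))) (w : CIdx j Λ' → ℝ)
      (_hw0 : ∀ i, a₀ * ((L : ℝ) ^ j) ^ (d + 1) ≤ w i) (_hw1 : ∀ i, w i ≤ a₁ * ((L : ℝ) ^ j) ^ (d + 1))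
      (b : PBond (⟨d + 1, L, m, K, hd, hL⟩ : Params) j) (y : Site (⟨d + 1, L, m, K, hd, hL⟩ : Params) j),
      ∑ b' ∈ univ.filter (fun b' : PBond (⟨d + 1, L, m, K, hd, hL⟩ : Params) j => b'.src = y), |(tsV1 hc Λ' w).Ct (EuclideanSpace.single b' (1 : ℝ)) b| ≤
        E / ((L : ℝ) ^ j) ^ (d + 1) * Real.exp (-(δ * torusSupNorm (Mk (⟨d + 1, L, m, K, hd, hL⟩ : Params) j)
          (rep (Mk (⟨d + 1, L, m, K, hd, hL⟩ : Params) j) b.src - rep (Mk (⟨d + 1, L, m, K, hd, hL⟩ : Params) j) y))) := by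
  obtain ⟨δC, hδC, hCt⟩ := covt_kernel_decay_uniform d L hd hL ha₀ ha₁
  set Γi : ℝ := (481 * ((d + 1 : ℕ) : ℝ) ^ 6 * (L : ℝ) ^ (2 * (d + 1) + 4))⁻¹ with hΓi
  have hL0 : 0 < L := by have := hL.2; omega
  have hLp : (0 : ℝ) < L := by exact_mod_cast hL0
  have hΓi0 : 0 < Γi := by positivity
  have hm0 : 0 < min a₀ 1 := lt_min ha₀ one_pos
  refine ⟨δC, hδC, 2 / (min a₀ 1 * Γi) * ((1 * (d + 1) : ℕ) : ℝ), by positivity, ?_⟩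
  intro m K j hc hj Λ' w hw0 hw1 b y
  set κ : ℝ := ((L : ℝ) ^ j) ^ 2 / (eta L j ^ (d + 1) * ((L : ℝ) ^ j) ^ 2) with hκ
  have hn0 : (0 : ℝ) < ((L : ℝ) ^ j) ^ (d + 1) := by positivity
  -- at `c = L^j`: `κ = n^{d+1}`
  have hκn : κ = ((L : ℝ) ^ j) ^ (d + 1) := by
    rw [hκ, eta, inv_pow, div_eq_iff (by positivity)]
    field_simp
  have hκ0 : 0 < κ := by rw [hκn]; exact hn0
  have hE0 : 0 ≤ 2 / (min (a₀ * κ) κ * Γi) := by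
    have : 0 < min (a₀ * κ) κ := lt_min (mul_pos ha₀ hκ0) hκ0
    positivity
  have h := blockBound_Ct_of_entry hc Λ' (w := w) hE0
    (fun b b' => hCt m K ((L : ℝ) ^ j) hc j hj Λ' w (fun i => by rw [← hκ, hκn]; exact hw0 i) (fun i => by rw [← hκ, hκn]; exact hw1 i) b b') b y
  refine h.trans (le_of_eq ?_)
  have hmin : min (a₀ * κ) κ = min a₀ 1 * κ := by rw [min_mul_of_nonneg _ _ hκ0.le, one_mul]
  rw [hmin, hκn]
  field_simp

end CtScaling

/-! ## §5  `D_λG^{(w′)}` at the scaling: [4] Proposition 1.2, member 2 of (1.110), BY NAME -/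

section DGE

variable {d L m K : ℕ} {hd : 1 ≤ d + 1} {hL : Odd L ∧ 1 < L} {j : ℕ}

open Classical in
/-- **[4] PROPOSITION 1.2, (1.110) MEMBER 2, FOR `D_λG^{(w′)}` AS A BLOCK BOUND** (`c = L^j`, `w′ = a·n^{d+1}`): there are `δ > 0`, `C ≥ 0` depending on
`d, L, a` only such that for every volume, `j ≤ m + K`, every direction `λ`, all fine bonds `b₀` and unit sites `y`,
`Σ_{b₀′ : y(b₀′₋) = y}|(D_λG^{(w′)})(e_{b₀′})_{b₀}| ≤ C·e^{−δ|y(b₀₋) − y|_T}` — p19's hypothesis-free `prop12Printed_allTori_allScales`, its member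
`e110_1` (`|(∇GJ)(x)| ≤ O(1)e^{−δ₀|y − y′|}|J|` for `x ∈ Δ̃(y)`, `supp J ⊂ Δ̃(y′)`; kernel `DGk`), r03's `GE_apply_eq_sum_Gk` and file 2's
`blockBound_of_cubeSup`. [cite: Balaban1984PropagatorsI, Prop. 1.2 (1.110) p.35; Balaban1984PropagatorsII, p.246 («They follow from the Proposition 1.2»)] -/
theorem blockBound_DGE_scaling (d L : ℕ) (hd : 1 ≤ d + 1) (hL : Odd L ∧ 1 < L) {a : ℝ} (ha : 0 < a) :
    ∃ δ : ℝ, 0 < δ ∧ ∃ C : ℝ, 0 ≤ C ∧ ∀ (m K j : ℕ)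
      (hj' : j ≤ (⟨d + 1, L, m, K, hd, hL⟩ : Params).m + (⟨d + 1, L, m, K, hd, hL⟩ : Params).K) (hc : ((L : ℝ) ^ j) ≠ 0)
      (hw' : (0 : ℝ) < a * ((L : ℝ) ^ j) ^ (d + 1)) (lam : Fin (d + 1))
      (b₀ : PBond (⟨d + 1, L, m, K, hd, hL⟩ : Params) 0) (y : Site (⟨d + 1, L, m, K, hd, hL⟩ : Params) j),
      ∑ b₀' ∈ univ.filter (fun b₀' : PBond (⟨d + 1, L, m, K, hd, hL⟩ : Params) 0 => iterBlockOf j b₀'.src = y),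
          |(((((L : ℝ) ^ j) • (onE (LinearMap.funLeft ℝ ℝ (fun b : PBond (⟨d + 1, L, m, K, hd, hL⟩ : Params) 0 =>
              (⟨b.src.shift lam, b.dir⟩ : PBond (⟨d + 1, L, m, K, hd, hL⟩ : Params) 0))) - LinearMap.id) :
          BondSpace (⟨d + 1, L, m, K, hd, hL⟩ : Params) →ₗ[ℝ] BondSpace (⟨d + 1, L, m, K, hd, hL⟩ : Params))) ∘ₗ
            GE (Domains.whole (P := (⟨d + 1, L, m, K, hd, hL⟩ : Params)) j hj') hc
              (w := fun _ => a * ((L : ℝ) ^ j) ^ (d + 1)) (fun _ => hw')) (EuclideanSpace.single b₀' (1 : ℝ)) b₀| ≤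
        C * Real.exp (-(δ * torusSupNorm (Mk (⟨d + 1, L, m, K, hd, hL⟩ : Params) j)
            (rep (Mk (⟨d + 1, L, m, K, hd, hL⟩ : Params) j) (iterBlockOf j b₀.src) - rep (Mk (⟨d + 1, L, m, K, hd, hL⟩ : Params) j) y))) := by
  obtain ⟨δ₀, C, Cα, Cε, Cαε, hδ₀, hC, H⟩ := prop12Printed_allTori_allScales (a := a) (d + 1) L ha
  refine ⟨δ₀, hδ₀, C, hC.le, fun m K j hj' hc hw' lam b₀ y => ?_⟩
  have h12 := prop12Hyps_of_ineq110_114 (R := torusRep (⟨d + 1, L, m, K, hd, hL⟩ : Params) j (deltaAData hj' a)) hC.le hδ₀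
    (H ⟨((⟨d + 1, L, m, K, hd, hL⟩ : Params), j), rfl, rfl, hj'⟩)
  have hρ : IsPseudoDist (fun t t' : Site (⟨d + 1, L, m, K, hd, hL⟩ : Params) j => torusSupNorm (Mk (⟨d + 1, L, m, K, hd, hL⟩ : Params) j)
      (rep (Mk (⟨d + 1, L, m, K, hd, hL⟩ : Params) j) t - rep (Mk (⟨d + 1, L, m, K, hd, hL⟩ : Params) j) t')) :=
    torusDist_isPseudoDist (Mk (⟨d + 1, L, m, K, hd, hL⟩ : Params) j)
  refine blockBound_of_cubeSup (ρ := (fun t t' : Site (⟨d + 1, L, m, K, hd, hL⟩ : Params) j => torusSupNorm (Mk (⟨d + 1, L, m, K, hd, hL⟩ : Params) j) (rep (Mk (⟨d + 1, L, m, K, hd, hL⟩ : Params) j) t - rep (Mk (⟨d + 1, L, m, K, hd, hL⟩ : Params) j) t')))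
    hρ _ (fun b₀ : PBond (⟨d + 1, L, m, K, hd, hL⟩ : Params) 0 => iterBlockOf j b₀.src)
    (fun b₀ : PBond (⟨d + 1, L, m, K, hd, hL⟩ : Params) 0 => iterBlockOf j b₀.src) le_rfl (fun x X y y' hX hsupp hx i hi => ?_) b₀ y
  set J : Site (⟨d + 1, L, m, K, hd, hL⟩ : Params) 0 × Fin (d + 1) → ℝ := fun jj => x ⟨jj.1, jj.2⟩ with hJ
  have hiy : iterBlockOf j i.src = y := eq_of_torusDist_le_zero hi
  -- `(D_λG x)(i) = (∇G J)(i₋, λ, μ(i))` with p09's kernel `DGk`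
  have hGE : ∀ b : PBond (⟨d + 1, L, m, K, hd, hL⟩ : Params) 0, GE (Domains.whole (P := (⟨d + 1, L, m, K, hd, hL⟩ : Params)) j hj') hc
      (w := fun _ => a * ((L : ℝ) ^ j) ^ (d + 1)) (fun _ => hw') x b = ∑ jj : Site (⟨d + 1, L, m, K, hd, hL⟩ : Params) 0 × Fin (d + 1),
        Gk hj' a (b.src, b.dir) jj * J jj := by
    intro b
    rw [GE_apply_eq_sum_Gk hj' (Domains.whole (P := (⟨d + 1, L, m, K, hd, hL⟩ : Params)) j hj') (qpE_whole_eq_zero_iff hj')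
      (fun _ => hw') ha (inner_QE_aE_whole hj' a) x b]
    exact (Fintype.sum_equiv (LatticeFieldCalculus.bondEquiv) _ _ fun jj => rfl).symm
  have hD : (((((L : ℝ) ^ j) • (onE (LinearMap.funLeft ℝ ℝ (fun b : PBond (⟨d + 1, L, m, K, hd, hL⟩ : Params) 0 =>
        (⟨b.src.shift lam, b.dir⟩ : PBond (⟨d + 1, L, m, K, hd, hL⟩ : Params) 0))) - LinearMap.id) :
          BondSpace (⟨d + 1, L, m, K, hd, hL⟩ : Params) →ₗ[ℝ] BondSpace (⟨d + 1, L, m, K, hd, hL⟩ : Params))) ∘ₗ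
      GE (Domains.whole (P := (⟨d + 1, L, m, K, hd, hL⟩ : Params)) j hj') hc (w := fun _ => a * ((L : ℝ) ^ j) ^ (d + 1)) (fun _ => hw')) x i =
      (DGk hj' a *ᵥ J) (i.src, lam, i.dir) := by
    rw [Dop_comp_apply, hGE, hGE, Matrix.mulVec, dotProduct, ← Finset.sum_sub_distrib, Finset.mul_sum]
    unfold DGk
    refine Finset.sum_congr rfl fun jj _ => ?_
    dsimp only
    ring
  have hsuppJ : ∀ jj : Site (⟨d + 1, L, m, K, hd, hL⟩ : Params) 0 × Fin (d + 1), J jj ≠ 0 →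
      jj.1 ∈ (torusRep (⟨d + 1, L, m, K, hd, hL⟩ : Params) j (deltaAData hj' a)).cube y' := by
    intro jj hjj
    have e : iterBlockOf j jj.1 = y' := eq_of_torusDist_le_zero (hsupp ⟨jj.1, jj.2⟩ hjj)
    rw [← e]
    exact mem_cube_blk hj' jj.1
  have hiin : i.src ∈ (torusRep (⟨d + 1, L, m, K, hd, hL⟩ : Params) j (deltaAData hj' a)).cube y := by
    rw [← hiy]
    exact mem_cube_blk hj' i.src
  have h := h12.e110_1 J y y' hsuppJ (i.src, lam, i.dir) hiin
  have hJn : ‖J‖ ≤ X := (pi_norm_le_iff_of_nonneg hX).2 fun jj => by rw [Real.norm_eq_abs]; exact hx ⟨jj.1, jj.2⟩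
  rw [hD]
  refine h.trans ?_
  rw [torusRep_dY, supDist_cast_eq_torusSupNorm]
  exact mul_le_mul_of_nonneg_left hJn (by positivity)

end DGE

end Literature.MathematicalPhysics.QuantumFieldTheory.Balaban1983to89.B6BlockDecayGradFactorsV1

end
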